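import Mathlib
import HarnessLib
import Summits.ResolutionOfSingularities.ResolutionOfSingularities.Theorems.WildQuotientsWildQuotientResolutionS1aD4Move4Ring
import Summits.ResolutionOfSingularities.ResolutionOfSingularities.Theorems.WildQuotientsWildQuotientResolutionS1aD4Move4Cover
import Summits.ResolutionOfSingularities.ResolutionOfSingularities.Theorems.WildQuotientsWildQuotientResolutionS1aNodeCentre
import Summits.ResolutionOfSingularities.ResolutionOfSingularities.Theorems.WildQuotientsWildQuotientResolutionS1aModelNodeAtlas
import Summits.ResolutionOfSingularities.ResolutionOfSingularities.Theorems.WildQuotientsWildQuotientResolutionS1aKillGlue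
import Summits.ResolutionOfSingularities.ResolutionOfSingularities.Theorems.WildQuotientsWildQuotientResolutionS1aOneShotKillChart

/-!
# S1a — INSTANCE I-3 (D₄): MOVE 4 OF MT-D₄ (v1.1) = THE KILL, over an ABSTRACT model of the node of the residual chart `[Y]₂`

[OURS · L1 W4.5c · lead-1 g13; plan-1 RULING R-F15e (I-3 move-by-move in the I-2 architecture), X-CERT v1.1 §2 / v1.2-D4ROWS move 4 (three producer
charts ALL KILLED), NOTES `D4 TREE OF RECORD`] — NOT statements of the manuscript; counted 0; AI-level work, weaker than expert review. Crux
stmt-ResolutionOfSingularities-17941 `CyclicQuotientFourfolds`, line `s1a-logminvertex` v13 (`stub_reachLowerInFX`).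

* ★★★ `GameFrame.GModel.d4_move4` — `M₃` a separated model, `W₃` a stable affine chart with node `DW₃` modelled by `Φ : DW₃.B ≃+* Q` (`τ = Φ⁻¹σΦ` with the
  move-4 rows of ✓`…S1aD4Move4Ring`: `τX₁ = X₁ + stY′s₃²`, `τW′ = W′ + s²tY′s₃`, `τx₃ = x₃ − stX₁ZW′s₃`; `t, s, Y′, Z, s₃`, the cover units `U_j` and `Gfix`
  fixed; `Y′, X₁, Z, U_j` units; K1′ for lead-1's centre `(s₃, W′, s)` and the degrees as HYPOTHESES), an atlas `𝔄₃` with `F_𝔄₃ ⊆ W₃`, and a cover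
  `M₃.V = W₃ ∪ ⋃ Uᵢ` with separating sections: then `(s₃:1, W′:1, s:2)` is an ADMISSIBLE move `𝒦₄` on `M₃` and EVERY realisation `π₄ : M₄ → M₃` carries a
  node atlas `𝔄₄` with EMPTY formal locus — `𝔞₄ ∋ A, B, C` (✓`d4m4_residual_mem`, units) so every cover element `c_j ∈ (A, B, C) ⊆ 𝔞₄`
  (✓`OneShotKill.coverElement_mem_span_u'`) and every residual section is `c_j·c_j⁻¹ = 1`. The leaf level `KillsIn 0` of the D₄ kill tree.
-/

set_option linter.dupNamespace false

noncomputable section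

open CategoryTheory Limits AlgebraicGeometry TopologicalSpace Topology Opposite
open Literature.AlgebraicGeometry.Resolution Literature.AlgebraicGeometry.RelativeSpec
open scoped LaurentPolynomial
open Summit.ResolutionOfSingularities.ResolutionOfSingularities.Theorems.WildQuotientResolution.S1
open Summit.ResolutionOfSingularities.ResolutionOfSingularities.Theorems.WildQuotientResolution.S1.NodeAtlas
open Summit.ResolutionOfSingularities.ResolutionOfSingularities.Theorems.WildQuotientResolution.S1.CoarseChart
open Summit.ResolutionOfSingularities.ResolutionOfSingularities.Theorems.WildQuotientResolution.S1.ProducerStep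
open Summit.ResolutionOfSingularities.ResolutionOfSingularities.Theorems.WildQuotientResolution.S1.NpFrame
open Summit.ResolutionOfSingularities.ResolutionOfSingularities.Theorems.WildQuotientResolution.S1.GoodCharts
open Summit.ResolutionOfSingularities.ResolutionOfSingularities.Theorems.WildQuotientResolution.S1.BlowupCharts
open Summit.ResolutionOfSingularities.ResolutionOfSingularities.Theorems.WildQuotientResolution.S1.KillableTransport
open Summit.ResolutionOfSingularities.ResolutionOfSingularities.Theorems.WildQuotientResolution.S1.KillCert
open Summit.ResolutionOfSingularities.ResolutionOfSingularities.Theorems.WildQuotientResolution.S1.ReesBigrading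
open Summit.ResolutionOfSingularities.ResolutionOfSingularities.Theorems.WildQuotientResolution.S1.NodeTransport
open Summit.ResolutionOfSingularities.ResolutionOfSingularities.Theorems.WildQuotientResolution.BlowupExit
open Summit.ResolutionOfSingularities.ResolutionOfSingularities.Theorems.WildQuotientResolution.S1.KillGlue

namespace Summit.ResolutionOfSingularities.ResolutionOfSingularities.Theorems.WildQuotientResolution.S1.GameFrame.GModel

variable {p : ℕ} {X' X₁ : Scheme.{0}} {q : X' ⟶ X₁} {G : Type} [Group G] {ρ : G →* Aut X'} {g₀ : G}

set_option maxHeartbeats 4000000 in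
/-- ★★★ **MOVE 4 OF MT-D₄ = THE KILL (abstract model of the node of `[Y]₂`): an admissible move every realisation of which carries a node atlas with EMPTY
formal locus.** See the module docstring. [OURS · L1 W4.5c · R-F15e I-3, move 4 of 4; NOT a statement of the manuscript] -/
theorem d4_move4 [Finite G] [NeZero p] (hp : p.Prime) (hG : ∀ g : G, g ∈ Subgroup.zpowers g₀)
    (M₂ : GModel p q G ρ g₀) [M₂.V.IsSeparated] (W₂ : M₂.act.StableAffineOpens) (DW₂ : NodeData p M₂.act g₀ W₂)
    {Q : Type} [CommRing Q] [CharP Q p] (Φ : letI := DW₂.instCommRing; DW₂.B ≃+* Q) (τ : Q ≃+* Q)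
    (hτ : letI := DW₂.instCommRing; ∀ x : Q, τ x = Φ (DW₂.σ (Φ.symm x)))
    -- generators of the model, the cover units and the rows of `τ`
    (t s Y' X₁ Z x₃ W' s₃ U₀ U₁ U₂ : Q) (Gfix : Set Q)
    (ht : τ t = t) (hs : τ s = s) (hY' : τ Y' = Y') (hZ : τ Z = Z) (hs₃ : τ s₃ = s₃) (hX₁ : τ X₁ = X₁ + s * t * Y' * s₃ ^ 2)
    (hW' : τ W' = W' + s ^ 2 * t * Y' * s₃) (hx₃ : τ x₃ = x₃ - s * t * X₁ * Z * W' * s₃) (hU₀ : τ U₀ = U₀) (hU₁ : τ U₁ = U₁) (hU₂ : τ U₂ = U₂)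
    (hfix : ∀ g ∈ Gfix, τ g = g) (hgen : Subring.closure (({t, s, Y', X₁, Z, x₃, W', s₃} : Set Q) ∪ Gfix) = ⊤)
    (hY'u : IsUnit Y') (hX₁u : IsUnit X₁) (hZu : IsUnit Z) (hU₀u : IsUnit U₀) (hU₁u : IsUnit U₁) (hU₂u : IsUnit U₂)
    -- degrees in the transported grading: the centre, and the raw cover elements (degree 0)
    (dA dB dC : Π j : Fin DW₂.m, ZMod (DW₂.r j)) (e : ℕ) (he : 0 < e)
    (hs₃d : letI := DW₂.instCommRing; letI := DW₂.instGradedRing; s₃ ∈ mapGrading DW₂.𝒜 Φ dA)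
    (hW'd : letI := DW₂.instCommRing; letI := DW₂.instGradedRing; W' ∈ mapGrading DW₂.𝒜 Φ dB)
    (hsd : letI := DW₂.instCommRing; letI := DW₂.instGradedRing; s ∈ mapGrading DW₂.𝒜 Φ dC)
    (hb₀d : letI := DW₂.instCommRing; letI := DW₂.instGradedRing; s₃ ^ (2 * (e * p)) * U₀ ∈ mapGrading DW₂.𝒜 Φ 0)
    (hb₁d : letI := DW₂.instCommRing; letI := DW₂.instGradedRing;
      (∏ i : ZMod p, (W' + (i.val : Q) * (s ^ 2 * t * Y' * s₃))) ^ (2 * e) * U₁ ∈ mapGrading DW₂.𝒜 Φ 0)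
    (hb₂d : letI := DW₂.instCommRing; letI := DW₂.instGradedRing; s ^ (e * p) * U₂ ∈ mapGrading DW₂.𝒜 Φ 0)
    -- K1′ for the centre `(s₃, W′, s)`
    (hK1 : RingTheory.Sequence.IsRegular Q (List.ofFn (![s₃, W', s] : Fin 3 → Q)))
    (hK1' : IsRegularRing (Q ⧸ Ideal.span (Set.range (![s₃, W', s] : Fin 3 → Q))))
    -- the closedness datum on `M₂`: a cover and separating sections
    {ι : Type} (U : ι → M₂.V.Opens) (hcov : ∀ x : M₂.V, x ∈ W₂.1 ∨ ∃ i, x ∈ U i) (u : ι → Γ(M₂.V, W₂.1)) (nu : ι → ℕ) (hnu : ∀ i, 0 < nu i)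
    (hu : letI := DW₂.instCommRing; letI := DW₂.instGradedRing; ∀ i,
      Φ ((DW₂.e (u i) : ↥(DW₂.𝒜 0)) : DW₂.B) ∈ (weightedFiltration (![s₃, W', s] : Fin 3 → Q) ![1, 1, 2]).ideal (nu i))
    (huU : ∀ i, ∀ v ∈ W₂.1, v ∈ U i → v ∈ M₂.V.basicOpen (u i))
    (𝔄₂ : NodeAtlasData p M₂.act g₀) (hF₂ : 𝔄₂.fLocus ⊆ (W₂.1 : Set M₂.V)) :
    ∃ (𝒦₃ : ReesFiltration M₂.V) (d₃ : ℕ), 0 < d₃ ∧ IsAdmissibleCentre p M₂.act g₀ 𝒦₃ d₃ ∧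
      ∀ (M₃ : GModel p q G ρ g₀) (π₃ : M₃.V ⟶ M₂.V), IsBlowup π₃ (𝒦₃.ideal d₃) → M₃.r = π₃ ≫ M₂.r →
        (∀ g : G, (M₃.act.aut g).hom ≫ π₃ = π₃ ≫ (M₂.act.aut g).hom) →
        ∃ 𝔄₃ : NodeAtlasData p M₃.act g₀, 𝔄₃.fLocus = ∅ := by
  classical
  letI := DW₂.instCommRing
  letI := DW₂.instGradedRing
  letI := mapGradedRing DW₂.𝒜 Φ
  have hp1 : p ≠ 1 := hp.one_lt.ne'
  have hk₃ : 0 < 2 * (e * p) := Nat.mul_pos two_pos (Nat.mul_pos he hp.pos)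
  have hw : ∀ i, 0 < (![1, 1, 2] : Fin 3 → ℕ) i := fun i => by fin_cases i <;> norm_num
  -- the transported node, read through `τ`
  have hτeq : (conj Φ DW₂.σ : Q ≃+* Q) = τ := RingEquiv.ext fun x => (hτ x).symm
  have htameτ : IsTameNode p Q (mapGrading DW₂.𝒜 Φ) τ := hτeq ▸ isTameNode_map DW₂.𝒜 Φ p DW₂.σ DW₂.tame
  have hσp : ∀ x : Q, (⇑τ)^[p] x = x := htameτ.2.2.2.2.2
  have hσL : ∀ t' : Γ(M₂.V, W₂.1), (((DW₂.e.trans (zeroRingEquiv DW₂.𝒜 Φ)) ((M₂.act.aut g₀⁻¹).hom.appLE W₂.1 W₂.1 (W₂.2.1 g₀⁻¹).ge t') :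
      ↥(mapGrading DW₂.𝒜 Φ 0)) : Q) = τ (((DW₂.e.trans (zeroRingEquiv DW₂.𝒜 Φ)) t' : ↥(mapGrading DW₂.𝒜 Φ 0)) : Q) := fun t' => by
    change Φ ((DW₂.e (actO M₂.act W₂ g₀ t') : ↥(DW₂.𝒜 0)) : DW₂.B) = τ (Φ ((DW₂.e t' : ↥(DW₂.𝒜 0)) : DW₂.B))
    rw [DW₂.intertwine t', hτ, Φ.symm_apply_apply]
  have hf₃ : ∀ i : Fin 3, (![s₃, W', s] : Fin 3 → Q) i ∈ mapGrading DW₂.𝒜 Φ ((![dA, dB, dC] : Fin 3 → Π j : Fin DW₂.m, ZMod (DW₂.r j)) i) := by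
    intro i; fin_cases i
    · exact hs₃d
    · exact hW'd
    · exact hsd
  have hσJ₃ := D4.d4m4_map_le τ t s Y' X₁ Z x₃ W' s₃ Gfix ht hs hY' hZ hs₃ hX₁ hW' hx₃ hfix hgen
  have hσJc : ∀ n : ℕ, ((weightedFiltration (![s₃, W', s] : Fin 3 → Q) ![1, 1, 2]).ideal n).map (conj Φ DW₂.σ : Q →+* Q) ≤
      (weightedFiltration (![s₃, W', s] : Fin 3 → Q) ![1, 1, 2]).ideal n := by rw [hτeq]; exact hσJ₃
  -- closedness of the traces from the separating sections
  have hcl₃ : ∀ n : ℕ, 0 < n →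
      closure (M₂.V.zeroLocus (U := W₂.1)
          ((((traceFiltration (mapGrading DW₂.𝒜 Φ) (![s₃, W', s] : Fin 3 → Q) ![1, 1, 2]).ideal n).comap
              ((DW₂.e.trans (zeroRingEquiv DW₂.𝒜 Φ) : Γ(M₂.V, W₂.1) ≃+* ↥(mapGrading DW₂.𝒜 Φ 0)) : Γ(M₂.V, W₂.1) →+* ↥(mapGrading DW₂.𝒜 Φ 0)) :
            Ideal Γ(M₂.V, W₂.1)) : Set Γ(M₂.V, W₂.1)) ∩ (W₂.1 : Set M₂.V)) ⊆ (W₂.1 : Set M₂.V) := by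
    intro n hn
    refine closure_zeroLocus_inter_subset_of_cover W₂.1 U hcov _ u (fun i => ⟨n, hn, ?_⟩) huU
    change (DW₂.e.trans (zeroRingEquiv DW₂.𝒜 Φ)) (u i ^ n) ∈ (traceFiltration (mapGrading DW₂.𝒜 Φ) (![s₃, W', s] : Fin 3 → Q) ![1, 1, 2]).ideal n
    rw [mem_traceFiltration_iff, map_pow, SetLike.GradeZero.coe_pow]
    change (Φ ((DW₂.e (u i) : ↥(DW₂.𝒜 0)) : DW₂.B)) ^ n ∈ _
    have h := Ideal.pow_mem_pow (hu i) n
    have hle := Veronese.idealFiltration_pow_le (weightedFiltration (![s₃, W', s] : Fin 3 → Q) ![1, 1, 2]) (nu i) n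
    exact (weightedFiltration (![s₃, W', s] : Fin 3 → Q) ![1, 1, 2]).antitone (Nat.le_mul_of_pos_left n (hnu i)) (hle h)
  -- ### the centre of move 3
  obtain ⟨𝒦₃, d₃, hd₃, hadm₃, -, hG𝒦₃, h𝒦₃O, hver₃, hsupp₃⟩ := exists_isAdmissibleCentre_of_node hG M₂ W₂ DW₂ Φ (by norm_num : 0 < 3)
    (![s₃, W', s] : Fin 3 → Q) (![dA, dB, dC]) ![1, 1, 2] hw hf₃ hK1 hK1' hσJc hcl₃
  refine ⟨𝒦₃, d₃, hd₃, hadm₃, fun M₃ π₃ hbl₃ hr₃ hcomm₃ => ?_⟩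
  -- ### the realisation `M₃`: cover, (H1), residual, atlas
  obtain ⟨hdeg0, hdeg1, hdeg2⟩ := D4.d4m4_y_deg t s Y' W' s₃ U₀ U₁ U₂ (p := p) e d₃ (mapGrading DW₂.𝒜 Φ) hb₀d hb₁d hb₂d
  obtain ⟨y', hy'0, hy'1, hy'2⟩ : ∃ y' : Fin 3 → ↥(mapGrading DW₂.𝒜 Φ 0), y' 0 = ⟨_, hdeg0⟩ ∧ y' 1 = ⟨_, hdeg1⟩ ∧ y' 2 = ⟨_, hdeg2⟩ :=
    ⟨![⟨_, hdeg0⟩, ⟨_, hdeg1⟩, ⟨_, hdeg2⟩], rfl, rfl, rfl⟩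
  have hy'v0 : ((y' 0 : ↥(mapGrading DW₂.𝒜 Φ 0)) : Q) = (s₃ ^ (2 * (e * p)) * U₀) ^ d₃ := congrArg Subtype.val hy'0
  have hy'v1 : ((y' 1 : ↥(mapGrading DW₂.𝒜 Φ 0)) : Q) = ((∏ i : ZMod p, (W' + (i.val : Q) * (s ^ 2 * t * Y' * s₃))) ^ (2 * e) * U₁) ^ d₃ :=
    congrArg Subtype.val hy'1
  have hy'v2 : ((y' 2 : ↥(mapGrading DW₂.𝒜 Φ 0)) : Q) = (s ^ (e * p) * U₂) ^ d₃ := congrArg Subtype.val hy'2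
  obtain ⟨hmem0, hmem1, hmem2⟩ := D4.d4m4_y_mem t s Y' W' s₃ U₀ U₁ U₂ (p := p) e d₃
  have hy' : ∀ j, y' j ∈ (traceFiltration (mapGrading DW₂.𝒜 Φ) (![s₃, W', s] : Fin 3 → Q) ![1, 1, 2]).ideal (d₃ * (2 * (e * p))) := by
    intro j
    rw [mem_traceFiltration_iff]
    fin_cases j
    · exact (congrArg (fun x : Q => x ∈ (weightedFiltration (![s₃, W', s] : Fin 3 → Q) ![1, 1, 2]).ideal (d₃ * (2 * (e * p)))) hy'v0).mpr hmem0
    · exact (congrArg (fun x : Q => x ∈ (weightedFiltration (![s₃, W', s] : Fin 3 → Q) ![1, 1, 2]).ideal (d₃ * (2 * (e * p)))) hy'v1).mpr hmem1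
    · exact (congrArg (fun x : Q => x ∈ (weightedFiltration (![s₃, W', s] : Fin 3 → Q) ![1, 1, 2]).ideal (d₃ * (2 * (e * p)))) hy'v2).mpr hmem2
  obtain ⟨hfix0, hfix1, hfix2⟩ := D4.d4m4_y_fixed τ t s Y' W' s₃ U₀ U₁ U₂ ht hs hY' hs₃ hW' hU₀ hU₁ hU₂ (p := p) e d₃ hp1
  have hσy' : ∀ j, τ (y' j : Q) = y' j := by
    intro j
    fin_cases j
    · exact (congrArg τ hy'v0).trans (hfix0.trans hy'v0.symm)
    · exact (congrArg τ hy'v1).trans (hfix1.trans hy'v1.symm)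
    · exact (congrArg τ hy'v2).trans (hfix2.trans hy'v2.symm)
  have hc0' : ((coverElement (mapGrading DW₂.𝒜 Φ) (![s₃, W', s] : Fin 3 → Q) ![1, 1, 2] (d₃ * (2 * (e * p))) (y' 0) (hy' 0) :
      ↥(cobordantAlgebra (![s₃, W', s] : Fin 3 → Q) ![1, 1, 2])) : Q[T;T⁻¹]) =
      LaurentPolynomial.C ((s₃ ^ (2 * (e * p)) * U₀) ^ d₃) * LaurentPolynomial.T (((d₃ * (2 * (e * p))) : ℕ) : ℤ) :=
    (coe_coverElement (mapGrading DW₂.𝒜 Φ) (![s₃, W', s] : Fin 3 → Q) ![1, 1, 2] (d₃ * (2 * (e * p))) (y' 0) (hy' 0)).trans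
      (congrArg (fun x : Q => LaurentPolynomial.C x * LaurentPolynomial.T (((d₃ * (2 * (e * p))) : ℕ) : ℤ)) hy'v0)
  have hc1' : ((coverElement (mapGrading DW₂.𝒜 Φ) (![s₃, W', s] : Fin 3 → Q) ![1, 1, 2] (d₃ * (2 * (e * p))) (y' 1) (hy' 1) :
      ↥(cobordantAlgebra (![s₃, W', s] : Fin 3 → Q) ![1, 1, 2])) : Q[T;T⁻¹]) =
      LaurentPolynomial.C (((∏ i : ZMod p, (W' + (i.val : Q) * (s ^ 2 * t * Y' * s₃))) ^ (2 * e) * U₁) ^ d₃) *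
        LaurentPolynomial.T (((d₃ * (2 * (e * p))) : ℕ) : ℤ) :=
    (coe_coverElement (mapGrading DW₂.𝒜 Φ) (![s₃, W', s] : Fin 3 → Q) ![1, 1, 2] (d₃ * (2 * (e * p))) (y' 1) (hy' 1)).trans
      (congrArg (fun x : Q => LaurentPolynomial.C x * LaurentPolynomial.T (((d₃ * (2 * (e * p))) : ℕ) : ℤ)) hy'v1)
  have hc2' : ((coverElement (mapGrading DW₂.𝒜 Φ) (![s₃, W', s] : Fin 3 → Q) ![1, 1, 2] (d₃ * (2 * (e * p))) (y' 2) (hy' 2) :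
      ↥(cobordantAlgebra (![s₃, W', s] : Fin 3 → Q) ![1, 1, 2])) : Q[T;T⁻¹]) =
      LaurentPolynomial.C ((s ^ (e * p) * U₂) ^ d₃) * LaurentPolynomial.T (((d₃ * (2 * (e * p))) : ℕ) : ℤ) :=
    (coe_coverElement (mapGrading DW₂.𝒜 Φ) (![s₃, W', s] : Fin 3 → Q) ![1, 1, 2] (d₃ * (2 * (e * p))) (y' 2) (hy' 2)).trans
      (congrArg (fun x : Q => LaurentPolynomial.C x * LaurentPolynomial.T (((d₃ * (2 * (e * p))) : ℕ) : ℤ)) hy'v2)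
  have hrad' : ∀ i : Fin 3, cobordantAlgebra.u' (![s₃, W', s] : Fin 3 → Q) ![1, 1, 2] i ∈
      (Ideal.span (Set.range fun j => coverElement (mapGrading DW₂.𝒜 Φ) (![s₃, W', s] : Fin 3 → Q) ![1, 1, 2] (d₃ * (2 * (e * p))) (y' j) (hy' j))).radical := by
    intro i
    have h := D4.d4m4_hrad t s Y' W' s₃ U₀ U₁ U₂ (p := p) e d₃ hU₀u hU₁u hU₂u _ _ _ hc0' hc1' hc2' i
    refine Ideal.radical_mono (Ideal.span_mono ?_) h
    refine Set.insert_subset_iff.mpr ⟨⟨0, rfl⟩, Set.insert_subset_iff.mpr ⟨⟨1, rfl⟩, Set.singleton_subset_iff.mpr ⟨2, rfl⟩⟩⟩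
  -- (H1) and «every cover element lies in the residual ideal»
  have hH1 := D4.d4m4_augmentationIdeal_sigmaR_le τ t s Y' X₁ Z x₃ W' s₃ Gfix ht hs hY' hZ hs₃ hX₁ hW' hx₃ hfix hgen hp.pos hσp
  obtain ⟨hr0, hr1, hr2⟩ := D4.d4m4_residual_mem τ t s Y' X₁ Z x₃ W' s₃ Gfix ht hs hY' hZ hs₃ hX₁ hW' hx₃ hfix hgen hp.pos hσp
  -- the three kill rows, freed of their unit factors: `A, B, C ∈ 𝔞₄`, hence every cover element lies in `𝔞₄`
  have hunit : ∀ {x : Q} (_ : IsUnit x) {z : ↥(cobordantAlgebra (![s₃, W', s] : Fin 3 → Q) ![1, 1, 2])}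
      {I : Ideal ↥(cobordantAlgebra (![s₃, W', s] : Fin 3 → Q) ![1, 1, 2])}, algebraMap Q _ x * z ∈ I → z ∈ I := by
    intro x hx z I hz
    obtain ⟨u, hu⟩ := hx.map (algebraMap Q ↥(cobordantAlgebra (![s₃, W', s] : Fin 3 → Q) ![1, 1, 2]))
    have hz' : z = ↑u⁻¹ * (algebraMap Q _ x * z) := by rw [← hu, ← mul_assoc, Units.inv_mul, one_mul]
    rw [hz']
    exact Ideal.mul_mem_left _ _ hz
  have hspan : Ideal.span (Set.range (cobordantAlgebra.u' (![s₃, W', s] : Fin 3 → Q) ![1, 1, 2])) ≤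
      (augmentationIdeal (sigmaR τ (![s₃, W', s] : Fin 3 → Q) ![1, 1, 2] hσJ₃ hp.pos hσp)).colon
        (Ideal.span {algebraMap Q ↥(cobordantAlgebra (![s₃, W', s] : Fin 3 → Q) ![1, 1, 2]) (s * t * s₃) * cobordantAlgebra.s (![s₃, W', s] : Fin 3 → Q) ![1, 1, 2]}) := by
    refine Ideal.span_le.mpr ?_
    rintro _ ⟨j, rfl⟩
    fin_cases j
    · exact hunit hY'u hr0
    · have h := hr1
      rw [← map_mul] at h
      exact hunit (hX₁u.mul hZu) h
    · have h := hr2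
      rw [mul_comm (cobordantAlgebra.u' (![s₃, W', s] : Fin 3 → Q) ![1, 1, 2] 2)] at h
      exact hunit hY'u h
  have hcm : ∀ j, coverElement (mapGrading DW₂.𝒜 Φ) (![s₃, W', s] : Fin 3 → Q) ![1, 1, 2] (d₃ * (2 * (e * p))) (y' j) (hy' j) ∈
      (augmentationIdeal (sigmaR τ (![s₃, W', s] : Fin 3 → Q) ![1, 1, 2] hσJ₃ hp.pos hσp)).colon
        (Ideal.span {algebraMap Q ↥(cobordantAlgebra (![s₃, W', s] : Fin 3 → Q) ![1, 1, 2]) (s * t * s₃) * cobordantAlgebra.s (![s₃, W', s] : Fin 3 → Q) ![1, 1, 2]}) :=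
    fun j => hspan (OneShotKill.coverElement_mem_span_u' (mapGrading DW₂.𝒜 Φ) (![s₃, W', s] : Fin 3 → Q) ![1, 1, 2] (d₃ * (2 * (e * p))) (y' j) (hy' j)
      (Nat.mul_pos hd₃ hk₃))
  -- the atlas of move 3
  obtain ⟨OW₃, hOW₃aff, hOW₃eq, E₃, htame₃, hE₃, hpin₃, 𝔄₃, hF₃⟩ := exists_moveAtlas_of_node hp.pos hG M₂ M₃ 𝔄₂ W₂ DW₂.affine
    DW₂.r (mapGrading DW₂.𝒜 Φ) (![s₃, W', s] : Fin 3 → Q) ![1, 1, 2] hf₃ τ (DW₂.e.trans (zeroRingEquiv DW₂.𝒜 Φ)) htameτ hσp hσL hw hK1 hK1' hσJ₃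
    𝒦₃ d₃ hG𝒦₃ h𝒦₃O hver₃ hsupp₃ π₃ hbl₃ hr₃ hcomm₃ hk₃ y' hy' hσy' hrad'
    (algebraMap Q ↥(cobordantAlgebra (![s₃, W', s] : Fin 3 → Q) ![1, 1, 2]) (s * t * s₃) * cobordantAlgebra.s (![s₃, W', s] : Fin 3 → Q) ![1, 1, 2]) hH1 (fun _ => 1)
    (fun j => ![algebraMap _ (ChartRing (mapGrading DW₂.𝒜 Φ) (![s₃, W', s] : Fin 3 → Q) ![1, 1, 2] (d₃ * (2 * (e * p))) (y' j) (hy' j))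
        (coverElement (mapGrading DW₂.𝒜 Φ) (![s₃, W', s] : Fin 3 → Q) ![1, 1, 2] (d₃ * (2 * (e * p))) (y' j) (hy' j)) *
      IsLocalization.Away.invSelf (coverElement (mapGrading DW₂.𝒜 Φ) (![s₃, W', s] : Fin 3 → Q) ![1, 1, 2] (d₃ * (2 * (e * p))) (y' j) (hy' j))])
    (fun j l => by
      fin_cases l
      exact residualSection_mem_chartNodeGrading_zero DW₂.r (mapGrading DW₂.𝒜 Φ) (![s₃, W', s] : Fin 3 → Q) ![1, 1, 2] hf₃ (y' j) (hy' j)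
        (coverElement_mem_reesPiece (mapGrading DW₂.𝒜 Φ) (![s₃, W', s] : Fin 3 → Q) ![1, 1, 2] (d₃ * (2 * (e * p))) (y' j) (hy' j)))
    (fun j l => by
      fin_cases l
      exact residualSection_mem_map DW₂.r (mapGrading DW₂.𝒜 Φ) (![s₃, W', s] : Fin 3 → Q) ![1, 1, 2] (y' j) (hy' j) (hcm j))
  -- every producer chart is killed: its residual section is `1`
  have hzW : ∀ j, ∀ v ∈ (OW₃ j).1, v ∈ M₃.V.basicOpen
      (letI := chartNodeGradedRing DW₂.r (mapGrading DW₂.𝒜 Φ) (![s₃, W', s] : Fin 3 → Q) ![1, 1, 2] hf₃ (d₃ * (2 * (e * p))) (y' j) (hy' j);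
        (E₃ j).symm ⟨_, residualSection_mem_chartNodeGrading_zero DW₂.r (mapGrading DW₂.𝒜 Φ) (![s₃, W', s] : Fin 3 → Q) ![1, 1, 2] hf₃ (y' j) (hy' j)
          (coverElement_mem_reesPiece (mapGrading DW₂.𝒜 Φ) (![s₃, W', s] : Fin 3 → Q) ![1, 1, 2] (d₃ * (2 * (e * p))) (y' j) (hy' j))⟩) := by
    intro j v hv
    letI := chartNodeGradedRing DW₂.r (mapGrading DW₂.𝒜 Φ) (![s₃, W', s] : Fin 3 → Q) ![1, 1, 2] hf₃ (d₃ * (2 * (e * p))) (y' j) (hy' j)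
    have h1 : (⟨_, residualSection_mem_chartNodeGrading_zero DW₂.r (mapGrading DW₂.𝒜 Φ) (![s₃, W', s] : Fin 3 → Q) ![1, 1, 2] hf₃ (y' j) (hy' j)
          (coverElement_mem_reesPiece (mapGrading DW₂.𝒜 Φ) (![s₃, W', s] : Fin 3 → Q) ![1, 1, 2] (d₃ * (2 * (e * p))) (y' j) (hy' j))⟩ :
        ↥((chartNodeGrading DW₂.r (mapGrading DW₂.𝒜 Φ) (![s₃, W', s] : Fin 3 → Q) ![1, 1, 2] hf₃ (d₃ * (2 * (e * p))) (y' j) (hy' j)) 0)) = 1 :=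
      Subtype.ext (IsLocalization.Away.mul_invSelf _)
    rw [h1, map_one, Scheme.basicOpen_of_isUnit _ isUnit_one]
    exact hv
  refine ⟨𝔄₃, Set.eq_empty_iff_forall_notMem.mpr fun v hv => ?_⟩
  rcases hF₃ hv with hold | hnew
  · exact hold.2 (hF₂ hold.1)
  · obtain ⟨j, hvW, hvR⟩ := Set.mem_iUnion.mp hnew
    exact hvR 0 (hzW j v hvW)

end Summit.ResolutionOfSingularities.ResolutionOfSingularities.Theorems.WildQuotientResolution.S1.GameFrame.GModel

end
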